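import Literature.MathematicalPhysics.QuantumFieldTheory.Balaban1983to89.B9Prop26DirichletBondReading
import Literature.MathematicalPhysics.QuantumFieldTheory.Balaban1983to89.B9Cor35GpDirInputsAtOne
import Literature.MathematicalPhysics.QuantumFieldTheory.Balaban1983to89.B9Eq3105DirichletBondLettersAtOneY
import Literature.MathematicalPhysics.QuantumFieldTheory.Balaban1983to89.B6Prop26DirichletPrinted
import Literature.MathematicalPhysics.QuantumFieldTheory.Balaban1983to89.B9Cor36GpCubeEntriesAtV

/-!
# `Balaban1983to89.B9Cor35GDirInputsAtOne` — [Balaban1985BackgroundPropagators] Corollary 3.5 p. 407 («with U = 1, these theorems were proved in [4]»)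
# FOR PRINT's DIRICHLET BOND CUBE LETTER `G_□ = (Ω₀(Δ_{loc,□} − DP_□D*)Ω₀)⁻¹` OF p. 409 l. 3–5 (road (B5)): THE `U = 1` BINDERS OF THE BOND-SECTOR
# `G`-STEP AT THE PADDED DIRICHLET BOND LETTERS — `Δa = conj b(padΔ(1))`, `G = conj b((padΔ(1))⁻¹)`, `Δa·G = 1 = G·Δa`, the interior letter
# `conj b((𝟙_B K_B 𝟙_B)♯)` and ITS THREE (3.42)-TYPE ROWS, CONDITIONAL BY NAME on [Balaban1984PropagatorsII] Prop. 2.6 for `G(Ω)` (p. 248;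
# `B6.Prop26DirichletPrinted`) INSTANTIATED AT THE PRINT-FAITHFUL FAMILY — the bond twin of `B9Cor35GpDirInputsAtOne` (UNIT 1), seat dag-n06-c g33, FILE 2

statement-level skeleton of published theorems with citation tags; proofs where landed; nothing here is a claim about the Yang–Mills mass gap

CITATION HEADER (lean-in-tree rule).  B9 = T. Bałaban, *Propagators for lattice gauge theories in a background field*, Commun. Math. Phys. **99** (1985)
389–434 [Balaban1985BackgroundPropagators] (held `paper:balaban1985-cmp99-background-propagators`; journal page = PDF page + 388): p. 408 (last lines)–p. 409
l. 5 «let us define a sequence {Ω_n(□)}_{n=0,…,j+1} … This sequence satisfies the conditions (2.1), (2.2) … Ω₀(□) ⊂ □⁵ … The operators constructed for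
this sequence, which we denote by G′_□(U), C_□(U) = (Q′(U)G′_□²(U)Q′*(U))⁻¹, G_□(U), satisfy all the inequalities of Theorems 3.1–3.3 correspondingly»;
p. 394 l. 24–33 (Dirichlet conventions, «Ω₀Δ′_aΩ₀»); (3.25)–(3.27) pp. 394–395 («It coincides with Δ_a in (2.19) if U = 1»); Thm 3.3 p. 399; (3.42)
p. 397; Cor. 3.5 p. 407 l. 26–35 («This allows us to prove Theorems 3.1–3.3 in some special situations, where we can use the results of [4]. There we
have proved these theorems for operators with the external gauge field configuration U = 1»).  [4] = B6 = T. Bałaban, *Propagators and renormalization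
transformations for lattice gauge theories. II*, Commun. Math. Phys. **96** (1984) 223–250 [Balaban1984PropagatorsII]: Prop. 2.6 (2.136) p. 247; p. 228
after (2.35) («G(Ω) = (Δ_a↾Ω)⁻¹ = (ΩΔ_aΩ)⁻¹ … All the reasonings and the results of this paper hold, with minor and obvious changes, for the operators
G(Ω)»); p. 248 l. 4–5 («this theorem holds for the operators G(Ω) with Dirichlet boundary conditions on Ωᶜ, Ω ⊃ Ω₁»); (2.51) p. 232.
[Balaban1983RegularityDecay] (2.42) p. 584 (the Dirichlet site kernel by images, g31).  Rows B9.Cor3.5 × B9.Thm3.3 × B6.Prop2.6 (cells only).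

WHY THIS FILE (director-ym №596/№599/№606: road (B5) = print's own road for the BOND rows of the N06 (γ) heads at `U = 1` — «local periodic-cube
vector pieces ⊕ vector RW gluing ⊕ Dirichlet-on-Ωᶜ by compression, with [B6] Prop 2.6-for-G(Ω) displayed BY NAME as a cite-tagged Literature fact
wherever not discharged»; FIRST DELIVERABLE = «the U = 1 Dirichlet bond kernel bound … the bond twin of UNIT 1 `thm31_dir_allOrientations`»; dag-lead g46
WORDS 814/822; this seat's LOCATED-33/34).  The bond-sector `G`-step of Cor. 3.5 / Thm 3.4 (r05's `B9Cor35GCubeInputsAtOne.gStep_cube`, r06's letter-free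
`B9Ineq385VG`) wants, at `U = 1`, realified letters `Δa`, `G` with `Δa·G = 1 = G·Δa` and the (3.42)-type rows `G ≺ A(Lⁿη)²e^{−δd}`, `∇_νG ≺ A(Lⁿη)e^{−δd}`,
`ΔG ≺ Ae^{−δd}` over `toB6 (geoCK i □)`.  For the WHOLE-TORUS cube letter r05 proved them from the V1 torus edition of [4] Prop. 2.6 (`thm33_GK_cube`).
For print's DIRICHLET letter on `Ω₀(□)` ([B9] p. 394: every operator of a sequence starting at `Ω₀` carries Dirichlet conditions on `Ω₀ᶜ`) the `U = 1`
decay is [4] Prop. 2.6 FOR `G(Ω)` — asserted in print (p. 228, p. 248), typed as the named fact `B6.Prop26DirichletPrinted` (lit-balaban typer g57), NOT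
proved in the tree (the bond method of images is not print's road, №599; the compression principle `B6GOmega` is single-scale).  THIS FILE: §1 the padded
Dirichlet bond pair at `U = 1` for ANY flat operator `T₁ = M♯` and ANY real `K_B` inverting the compression of `M` to the bond set `B` (def-Y's file H lift
clause): the realified letters, both inverse laws, the interior letter `conj b((𝟙_B K_B 𝟙_B)♯)` and the interior/exterior split; §2 the three rows of the
interior letter from (2.136)-shaped rows of the real kernel (FILE 1's reading), hence ★`rows_GiK_of_ineq2136` — GENERIC in `T₁` (it serves the member-
levelled letter of the current heads with a RAW displayed decay hypothesis, and the cube-levelled letter below with the NAMED one); §3 THE PRINT-FAITHFUL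
INSTANCE of the named fact — index = (member, cover cube), domain sort = site sets, admissible = `Ω₀(□) = dirDomY i □` (g31's Dirichlet box ⊋ `C₁(□)`:
a level-0 collar of at least one top block, p. 228's «Ω ⊃ Ω₁»), `GΩ` = the Dirichlet inverse of the CUBE SEQUENCE's own flat bond operator
`Δ_{loc,□}(1) − DP_□(1)D*` (n06-j's `mlocDirCMatY` at g31's site kernel `GpDirOneY` and the canonical block inverse) seen through (2.136) — and the
★★★ conditional theorem `thm33_GdK_cube_of_prop26Dirichlet`: the named fact ⇒ r05's three `U = 1` rows for the realified interior Dirichlet bond letter of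
every cube of every member, one set of constants, under the two displayed inverse sockets `hKX`, `hKB` of n06-j's reading (`hK` DISCHARGED by g31's
`compress_mul_GpDirOneY`).

WHAT IS PROVED (defs with bodies: `DadK`, `GdK`, `GiK`, `padKerB`, `invOnB`, `kxDirC`, `mDirC`, `kDirC`, `CubeIdxB`, `geoDirBI`, `domDirBI`, `admDirBI`,
`GDirBFam`; theorems; 0 sorry; 0 `def … : Prop` of a new fact; standard axioms):
* §1 (generic `T₁ = M♯`, `B`, `K_B`): `padKerB`, `padKerB_eq_add`, `DadK`, `GdK`, `GiK`, ★`ringInverse_dirPadY_liftOpY_eq` (`(padΔ(1))⁻¹ = (padKerB B K_B)♯`),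
  ★`DadK_mul_GdK` (both laws), `isUnit_dirPadY_of_hT1`, `GiK_eq_conj_liftOpY` (`= conj b((𝟙K_B𝟙)♯)`), `GdK_eq_GiK_add` (interior ⊕ exterior `(1 − 𝟙_B)♯`);
* §2 ★`hG_dirB`, ★`hDG_dirB`, ★`hLapG_dirB` (kernel rows ⇒ rows of `GiK`, `DK ν·GiK`, `LapK·GiK` over `toB6 (geoCK i □) Rr H` keyed by `blkBK`),
  ★★`rows_GiK_of_ineq2136` ((2.136) for `gFamOfKernelB i □ (𝟙K_B𝟙)` ⇒ the three rows);
* §3 `invOnB` (+ `invOnB_apply_of_mem/_of_not_mem`, `compr_invOnB`, ★`compr_eq_invOnB`), `kxDirC`, `mDirC`, `kDirC`, `mlocDirCMatY_eq_mDirC`, `compr_eq_kDirC`,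
  `CubeIdxB`, `geoDirBI`, `domDirBI`, `admDirBI`, `GDirBFam`, ★★★`thm33_GdK_cube_of_prop26Dirichlet`.

HONEST SCOPE / NOT CLAIMED.  CONDITIONAL BY NAME (D-0044): the decay is the printed assertion [4] p. 248 (`B6.Prop26DirichletPrinted`), displayed as the
hypothesis `h26` and NOT proved; this file adds the dictionary and the instantiation only.  The instance is print's object for the sequence `{Ω_n(□)}`:
the CUBE-FAMILY-levelled operator (r05's `deltaLocCubeY`, LOCATED-34), on g31's `Ω₀(□)` (an `O(L)`-top-block enlargement of print's `Ω₀(□) ⊂ □⁵`,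
declared in `B9CubeSequence408Mirrors`); its (2.1)–(2.2) are structure fields of `cubeFam`/`KIdx` (`Hyp21_22 := True`, FILE 1).  Two inverse sockets stay
DISPLAYED (`hKX`: blocks inside `Ω₀(□)`; `hKB`: bonds over `Ω₀(□)`; both are compressions of positive operators — [4] (2.147)/(2.78) — not inverted here).
The right entry `G∇*`, the Hölder / `L²` / (3.47) members and every `U ≠ 1` statement are NOT touched; the exterior rows of the padded letter are the
identity (continuum units: NOT of the `(Lⁿη)²` shape — hence the rows are stated for the INTERIOR letter and the split is given).  Nothing on `d = 4`, the
continuum, reflection positivity or the mass gap; NOT a node discharge; count-neutral; no row head changes.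

RELATED IN THE TREE, NOT DUPLICATED: `B9Cor35GpDirInputsAtOne` (UNIT 1: the SITE twin, proved outright from g31's images), r05's `B9Cor35GCubeInputsAtOne`
(whole-torus bond letter, proved from the V1 torus edition), n06-j's `B9Eq3105DirichletBondLettersAtOneY` (the `hT1` readings `mlocDirBMatY`/`mlocDirCMatY`,
consumed by name), def-Y's `OpsYCubeDirInverseBond` (file H: `GDirBY`, lift clause), `B6Prop26DirichletPrinted` (the named fact), `B6GOmega` (compression
principle, single-scale), FILE 1 `B9Prop26DirichletBondReading` (the reading engine).
-/

noncomputable section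

namespace Literature.MathematicalPhysics.QuantumFieldTheory.Balaban1983to89.B9Cor35GDirInputsAtOne

open Literature.MathematicalPhysics.QuantumFieldTheory.Balaban1983to89
open Literature.MathematicalPhysics.QuantumFieldTheory.Balaban1983to89.B6RandomWalk (HasMajorant hasMajorant_mono)
open Literature.MathematicalPhysics.QuantumFieldTheory.Balaban1983to89.B9Thm34Ext (toB6)
open Literature.MathematicalPhysics.QuantumFieldTheory.Balaban1983to89.B9Eq352DivFormLetters (conj)
open Literature.MathematicalPhysics.QuantumFieldTheory.Balaban1983to89.B6KLevelCensusIndexV1 (KIdx kGeo)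
open Literature.MathematicalPhysics.QuantumFieldTheory.Balaban1983to89.B6Cover236MultiLevelBlocks (cubes)
open Literature.MathematicalPhysics.QuantumFieldTheory.Balaban1983to89.B6GlobalChartV1L0 (blkV1)
open Literature.MathematicalPhysics.QuantumFieldTheory.Balaban1983to89.B6GradLegKLevelV1 (DV)
open Literature.MathematicalPhysics.QuantumFieldTheory.Balaban1983to89.B6LapLegKLevelV1 (LapV)
open Literature.MathematicalPhysics.QuantumFieldTheory.Balaban1983to89.B9CubeLettersOpsL0 (cubeFamY)
open Literature.MathematicalPhysics.QuantumFieldTheory.Balaban1983to89.B9CubeLettersBondOpsL0 (BlkCubeY)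
open Literature.MathematicalPhysics.QuantumFieldTheory.Balaban1983to89.B9CubeGeometryInputs (geoCK geoCK_len geoCK_dist)
open Literature.MathematicalPhysics.QuantumFieldTheory.Balaban1983to89.B9Cor35GpCubeInputsAtOne (hasMajorant_conj_of_liftY conj_one')
open Literature.MathematicalPhysics.QuantumFieldTheory.Balaban1983to89.B9Cor35GCubeInputsAtOne (blkBK DK LapK)
open Literature.MathematicalPhysics.QuantumFieldTheory.Balaban1983to89.B9Cor36GpCubeEntriesAtV (conj_add')
open Literature.MathematicalPhysics.QuantumFieldTheory.Balaban1983to89.B9Cor35GpDirInputsAtOne (dirDomY GpDirOneY)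
open Literature.MathematicalPhysics.QuantumFieldTheory.Balaban1983to89.B9CubeDirichletLetterAtOne (compress_mul_GpDirOneY)
open Literature.MathematicalPhysics.QuantumFieldTheory.Balaban1983to89.B9Cor35AtOneInverseLetters (eq_liftOpY_of_ringInverse liftOpY_mul liftOpY_one)
open Literature.MathematicalPhysics.QuantumFieldTheory.Balaban1983to89.B9Eq3105DirichletBondLettersAtOneY (xDirMatY pDirMatY mlocDirCMatY
  deltaLocCubeY_sub_DPDsDirCubeY_one)
open Literature.MathematicalPhysics.QuantumFieldTheory.Balaban1983to89.B9Prop26DirichletBondReading (geoDirB gFamOfKernelB hasMajorant_of_ineq2136 geoDirB_M)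
open Literature.MathematicalPhysics.QuantumFieldTheory.Balaban1983to89.Node00 (SiteY FBondY CfgY BondParY toKT liftY liftOpY liftOpY_liftY liftEndY liftEndY_liftY)
open Literature.MathematicalPhysics.QuantumFieldTheory.Balaban1983to89.Node00.OpsYLocalInverse (dirPadY dirInvY)
open Literature.MathematicalPhysics.QuantumFieldTheory.Balaban1983to89.Node00.OpsYCubeDirInverse (indDiagY indDiagY_apply indDiagY_mul_indDiagY compr_apply
  compr_mul_compr_eq_indDiagY dirPadY_mul_dirPadY_eq_one)
open Literature.MathematicalPhysics.QuantumFieldTheory.Balaban1983to89.Node00.OpsYCubeDirInverseBond (indProjY bondsOverY dirPadY_indProjY_liftOpY_liftY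
  dirPadY_indProjY_liftOpY isUnit_dirPadY_indProjY_liftOpY dirInvY_indProjY_liftOpY)
open Literature.MathematicalPhysics.QuantumFieldTheory.Balaban1983to89.Node00.OpsYCubeProjectionG (insideBlkY DPDsDirCubeY)
open scoped Matrix

variable {d ℓ : ℕ} {hd : 1 ≤ d + 1} {hL : Odd (ℓ + 1) ∧ 1 < ℓ + 1} {b₀ b₁ : ℝ}

/-! ## §1  The padded Dirichlet bond pair at `U = 1` in real coordinates, for ANY flat operator `T₁ = M♯`, bond set `B` and real inverse `K_B` on `B` -/

section Padded

variable {𝔸 : Type} [NormedRing 𝔸] [NormedAlgebra ℂ 𝔸]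
variable {ι : Type} [Fintype ι] (b : Module.Basis ι ℝ 𝔸)
variable (i : KIdx d ℓ hd hL b₀ b₁)

/-- **THE PADDED DIRICHLET BOND KERNEL `𝟙_B K_B 𝟙_B + (1 − 𝟙_B)`** — the real matrix of `(padΔ(1))⁻¹` for a flat bond operator padded to `B` (identity on the
exterior rows; the bond twin of UNIT 1's `GpDirPadW`). [cite: Balaban1985BackgroundPropagators, p.394 («Ω₀Δ′_aΩ₀ … Its inverse»), p.409 l.3–5 («G_□(U)»); Balaban1983RegularityDecay, (2.42) p.584] -/
def padKerB (B : Finset (FBondY i)) (KB : Matrix (FBondY i) (FBondY i) ℝ) : Matrix (FBondY i) (FBondY i) ℝ := dirPadY (indDiagY B) KB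

/-- `padKerB = 𝟙K𝟙 + (1 − 𝟙)` (interior kernel + identity on the exterior rows). [cite: Balaban1985BackgroundPropagators, p.394, bookkeeping] -/
theorem padKerB_eq_add (B : Finset (FBondY i)) (KB : Matrix (FBondY i) (FBondY i) ℝ) :
    padKerB i B KB = indDiagY B * KB * indDiagY B + (1 - indDiagY B) := rfl

variable (T₁ : (FBondY i → 𝔸) →ₗ[ℂ] (FBondY i → 𝔸)) (B : Finset (FBondY i))

/-- **the letter `Δa = conj b(padΔ(1))`** — the padded compression `𝟙_B T₁ 𝟙_B + (1 − 𝟙_B)` of the flat bond operator, realified (for def-Y's letters: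
`padDeltaLocBY … 1 = dirPadY (indProjY B) (Δ_loc(1) − Pl(1))`). [cite: Balaban1985BackgroundPropagators, (3.26) p.395, p.394, p.409 l.3–5, Cor. 3.5 p.407] -/
def DadK : Module.End ℝ (FBondY i × ι → ℝ) := conj b ((dirPadY (indProjY B) T₁).restrictScalars ℝ)

/-- **the letter `G = conj b((padΔ(1))⁻¹)`** (`Ring.inverse`), realified. [cite: Balaban1985BackgroundPropagators, (3.27) p.395, p.394, p.409 l.3–5, Cor. 3.5 p.407] -/
def GdK : Module.End ℝ (FBondY i × ι → ℝ) := conj b ((Ring.inverse (dirPadY (indProjY B) T₁)).restrictScalars ℝ)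

/-- **the INTERIOR letter `conj b(𝟙_B (padΔ(1))⁻¹ 𝟙_B)`** = the realified Dirichlet bond inverse `dirInvY 𝟙_B T₁` (for def-Y's letters: `GDirBY … 1`), zero
on the exterior. [cite: Balaban1985BackgroundPropagators, (3.27) p.395, p.394, p.409 l.3–5 («G_□(U)»), Cor. 3.5 p.407] -/
def GiK : Module.End ℝ (FBondY i × ι → ℝ) := conj b ((dirInvY (indProjY B) T₁).restrictScalars ℝ)

variable {T₁ B} {M KB : Matrix (FBondY i) (FBondY i) ℝ}

/-- the regime: `padΔ(1)` is a unit once a real `K_B` inverts the compression of `M` to `B` (def-Y's `isUnit_dirPadY_indProjY_liftOpY`).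
[cite: Balaban1985BackgroundPropagators, p.394 («Its inverse is denoted by G′»), Cor. 3.5 p.407; Balaban1983RegularityDecay, (2.42) p.584] -/
theorem isUnit_dirPadY_of_hT1 (hT1 : T₁ = liftOpY 𝔸 M)
    (hKB : M.submatrix (fun v : ↥B => (v : FBondY i)) (fun v : ↥B => (v : FBondY i)) *
      KB.submatrix (fun v : ↥B => (v : FBondY i)) (fun v : ↥B => (v : FBondY i)) = 1) :
    IsUnit (dirPadY (indProjY B) T₁) := by
  rw [hT1]; exact isUnit_dirPadY_indProjY_liftOpY B hKB

/-- ★ **THE MATRIX CLAUSE OF `(padΔ(1))⁻¹`**: `(padΔ(1))⁻¹ = (padKerB B K_B)♯`. [cite: Balaban1985BackgroundPropagators, p.394, Cor. 3.5 p.407, p.409 l.3–5; Balaban1983RegularityDecay, (2.42) p.584] -/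
theorem ringInverse_dirPadY_liftOpY_eq (hT1 : T₁ = liftOpY 𝔸 M)
    (hKB : M.submatrix (fun v : ↥B => (v : FBondY i)) (fun v : ↥B => (v : FBondY i)) *
      KB.submatrix (fun v : ↥B => (v : FBondY i)) (fun v : ↥B => (v : FBondY i)) = 1) :
    Ring.inverse (dirPadY (indProjY B) T₁) = liftOpY 𝔸 (padKerB i B KB) := by
  rw [hT1]
  exact eq_liftOpY_of_ringInverse rfl
    (dirPadY_mul_dirPadY_eq_one (indDiagY_mul_indDiagY B) (compr_mul_compr_eq_indDiagY B hKB)) (dirPadY_indProjY_liftOpY_liftY B M)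

/-- the `hT` clause of the realification for `G`: `(padΔ(1))⁻¹(f ⊗ E) = (padKerB f) ⊗ E`. [cite: Balaban1985BackgroundPropagators, Cor. 3.5 p.407, bookkeeping] -/
theorem ringInverse_dirPadY_liftY (hT1 : T₁ = liftOpY 𝔸 M)
    (hKB : M.submatrix (fun v : ↥B => (v : FBondY i)) (fun v : ↥B => (v : FBondY i)) *
      KB.submatrix (fun v : ↥B => (v : FBondY i)) (fun v : ↥B => (v : FBondY i)) = 1) (f : FBondY i → ℝ) (E : 𝔸) :
    (Ring.inverse (dirPadY (indProjY B) T₁)).restrictScalars ℝ (liftY f E) = liftY (padKerB i B KB *ᵥ f) E := by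
  rw [LinearMap.restrictScalars_apply, ringInverse_dirPadY_liftOpY_eq i hT1 hKB, liftOpY_liftY]

/-- ★ **THE BINDERS `hΔG`, `hGΔ` OF THE `G`-STEP AT THE DIRICHLET BOND LETTER**: `Δa·G = 1 = G·Δa` at `U = 1`.
[cite: Balaban1985BackgroundPropagators, (3.26)–(3.27) p.395, Thm 3.3 p.399, Cor. 3.5 p.407, p.409 l.3–5] -/
theorem DadK_mul_GdK (hT1 : T₁ = liftOpY 𝔸 M)
    (hKB : M.submatrix (fun v : ↥B => (v : FBondY i)) (fun v : ↥B => (v : FBondY i)) *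
      KB.submatrix (fun v : ↥B => (v : FBondY i)) (fun v : ↥B => (v : FBondY i)) = 1) :
    DadK b i T₁ B * GdK b i T₁ B = 1 ∧ GdK b i T₁ B * DadK b i T₁ B = 1 := by
  have hunit := isUnit_dirPadY_of_hT1 i hT1 hKB
  constructor
  · rw [DadK, GdK, ← B9Eq352DivFormLetters.conj_mul, Module.End.mul_eq_comp, ← LinearMap.restrictScalars_comp, ← Module.End.mul_eq_comp,
      Ring.mul_inverse_cancel _ hunit]
    exact conj_one' b
  · rw [DadK, GdK, ← B9Eq352DivFormLetters.conj_mul, Module.End.mul_eq_comp, ← LinearMap.restrictScalars_comp, ← Module.End.mul_eq_comp,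
      Ring.inverse_mul_cancel _ hunit]
    exact conj_one' b

/-- ★ **THE INTERIOR LETTER IS THE LIFT OF `𝟙_B K_B 𝟙_B`** (def-Y's lift clause `dirInvY_indProjY_liftOpY`).
[cite: Balaban1985BackgroundPropagators, (3.27) p.395, p.394, Cor. 3.5 p.407, p.409 l.3–5; Balaban1983RegularityDecay, (2.42) p.584] -/
theorem GiK_eq_conj_liftOpY (hT1 : T₁ = liftOpY 𝔸 M)
    (hKB : M.submatrix (fun v : ↥B => (v : FBondY i)) (fun v : ↥B => (v : FBondY i)) *
      KB.submatrix (fun v : ↥B => (v : FBondY i)) (fun v : ↥B => (v : FBondY i)) = 1) :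
    GiK b i T₁ B = conj b ((liftOpY 𝔸 (indDiagY B * KB * indDiagY B)).restrictScalars ℝ) := by
  rw [GiK, hT1, dirInvY_indProjY_liftOpY B hKB]

/-- the interior letter's `hT` clause: `(𝟙_B(padΔ(1))⁻¹𝟙_B)(f ⊗ E) = ((𝟙K_B𝟙) f) ⊗ E`. [cite: Balaban1985BackgroundPropagators, Cor. 3.5 p.407, bookkeeping] -/
theorem dirInvY_liftY (hT1 : T₁ = liftOpY 𝔸 M)
    (hKB : M.submatrix (fun v : ↥B => (v : FBondY i)) (fun v : ↥B => (v : FBondY i)) *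
      KB.submatrix (fun v : ↥B => (v : FBondY i)) (fun v : ↥B => (v : FBondY i)) = 1) (f : FBondY i → ℝ) (E : 𝔸) :
    (dirInvY (indProjY B) T₁).restrictScalars ℝ (liftY f E) = liftY ((indDiagY B * KB * indDiagY B) *ᵥ f) E := by
  rw [LinearMap.restrictScalars_apply, hT1, dirInvY_indProjY_liftOpY B hKB, liftOpY_liftY]


/-- ★ **INTERIOR ⊕ EXTERIOR**: `G = conj b((𝟙K_B𝟙)♯) + conj b((1 − 𝟙_B)♯)` — the exterior rows of the padded letter are the identity off `B` (continuum units: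
an `O(1)` diagonal, NOT of the `(Lⁿη)²` shape; a consumer compressing by `𝟙_B` never sees them). [cite: Balaban1985BackgroundPropagators, p.394 («Ω₀Δ′_aΩ₀»), p.409, bookkeeping] -/
theorem GdK_eq_GiK_add (hT1 : T₁ = liftOpY 𝔸 M)
    (hKB : M.submatrix (fun v : ↥B => (v : FBondY i)) (fun v : ↥B => (v : FBondY i)) *
      KB.submatrix (fun v : ↥B => (v : FBondY i)) (fun v : ↥B => (v : FBondY i)) = 1) :
    GdK b i T₁ B = GiK b i T₁ B + conj b ((liftOpY 𝔸 (1 - indDiagY B)).restrictScalars ℝ) := by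
  rw [GdK, GiK_eq_conj_liftOpY b i hT1 hKB, ringInverse_dirPadY_liftOpY_eq i hT1 hKB, padKerB_eq_add, ← conj_add' b]
  congr 1
  refine LinearMap.ext fun v => ?_
  simp only [LinearMap.restrictScalars_apply, LinearMap.add_apply, Node00.liftOpY_add]

end Padded

/-! ## §2  The three (3.42)-type rows of the interior letter from the rows of its real kernel -/

section Rows

variable {𝔸 : Type} [NormedRing 𝔸] [NormedAlgebra ℂ 𝔸]
variable {ι : Type} [Fintype ι] (b : Module.Basis ι ℝ 𝔸)
variable (i : KIdx d ℓ hd hL b₀ b₁) (q : ↥(cubes (toKT i).D.toDomains))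
variable {T₁ : (FBondY i → 𝔸) →ₗ[ℂ] (FBondY i → 𝔸)} {B : Finset (FBondY i)} {M KB : Matrix (FBondY i) (FBondY i) ℝ}

/-- ★ **ROW `hG` AT THE DIRICHLET BOND LETTER**: a block majorant `𝟙K_B𝟙 ≺ A(Lⁿη)²e^{−δd}` of the real interior kernel over the cube geometry gives the same
majorant for the realified interior letter. [cite: Balaban1985BackgroundPropagators, Thm 3.3 p.399, (3.42)₁ p.397, Cor. 3.5 p.407, p.409 l.1–5; Balaban1984PropagatorsII, Prop. 2.6 (2.136)₁ p.247, (2.51) p.232] -/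
theorem hG_dirB (hT1 : T₁ = liftOpY 𝔸 M)
    (hKB : M.submatrix (fun v : ↥B => (v : FBondY i)) (fun v : ↥B => (v : FBondY i)) *
      KB.submatrix (fun v : ↥B => (v : FBondY i)) (fun v : ↥B => (v : FBondY i)) = 1) {A δ : ℝ} (Rr : ℝ) (H : Prop)
    (h₁ : HasMajorant (g := toB6 (geoCK i q) Rr H) (blkV1 i.hN (cubeFamY i q)) (Matrix.toLin' (indDiagY B * KB * indDiagY B))
      (fun y y' => A * (geoCK i q).len y ^ 2 * Real.exp (-(δ * (geoCK i q).dist y y')))) :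
    HasMajorant (g := toB6 (geoCK i q) Rr H) (blkBK i q) (GiK b i T₁ B)
      (fun a a' => A * (geoCK i q).len a ^ 2 * Real.exp (-(δ * (geoCK i q).dist a a'))) := by
  rw [GiK]
  exact hasMajorant_conj_of_liftY b (g := toB6 (geoCK i q) Rr H) (blkV1 i.hN (cubeFamY i q)) _ _
    (fun f E => by rw [dirInvY_liftY i hT1 hKB, Matrix.toLin'_apply]) h₁

/-- ★ **ROWS `hDG ν` AT THE DIRICHLET BOND LETTER**: `∇_ν·(𝟙K_B𝟙) ≺ A(Lⁿη)e^{−δd}` gives `conj b(∇_ν)·GiK ≺ A(Lⁿη)e^{−δd}` (r05's `DK b i ν`).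
[cite: Balaban1985BackgroundPropagators, Thm 3.3 p.399, (3.42)₂ p.397, Cor. 3.5 p.407, p.409 l.1–5; Balaban1984PropagatorsII, Prop. 2.6 (2.136)₂ p.247] -/
theorem hDG_dirB (hT1 : T₁ = liftOpY 𝔸 M)
    (hKB : M.submatrix (fun v : ↥B => (v : FBondY i)) (fun v : ↥B => (v : FBondY i)) *
      KB.submatrix (fun v : ↥B => (v : FBondY i)) (fun v : ↥B => (v : FBondY i)) = 1) {A δ : ℝ} (Rr : ℝ) (H : Prop) (ν : Fin (d + 1))
    (h₂ : HasMajorant (g := toB6 (geoCK i q) Rr H) (blkV1 i.hN (cubeFamY i q))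
      (DV (P := B6GlobalChartV1.PV d ℓ i.m i.K hd hL) ν i.cf ∘ₗ Matrix.toLin' (indDiagY B * KB * indDiagY B))
      (fun y y' => A * (geoCK i q).len y * Real.exp (-(δ * (geoCK i q).dist y y')))) :
    HasMajorant (g := toB6 (geoCK i q) Rr H) (blkBK i q) (DK b i ν * GiK b i T₁ B)
      (fun a a' => A * (geoCK i q).len a * Real.exp (-(δ * (geoCK i q).dist a a'))) := by
  rw [DK, GiK, ← B9Eq352DivFormLetters.conj_mul]
  refine hasMajorant_conj_of_liftY b (g := toB6 (geoCK i q) Rr H) (blkV1 i.hN (cubeFamY i q)) _ _ (fun J E => ?_) h₂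
  rw [Module.End.mul_apply, dirInvY_liftY i hT1 hKB, LinearMap.restrictScalars_apply, liftEndY_liftY, LinearMap.comp_apply, Matrix.toLin'_apply]

/-- ★ **ROW FOR `ΔG` AT THE DIRICHLET BOND LETTER**: `Δ·(𝟙K_B𝟙) ≺ Ae^{−δd}` gives `conj b(Δ)·GiK ≺ Ae^{−δd}` (r05's `LapK b i`).
[cite: Balaban1985BackgroundPropagators, Thm 3.3 p.399, (3.42) p.397, Cor. 3.5 p.407, p.409 l.1–5; Balaban1984PropagatorsII, Prop. 2.6 (2.136)₄ p.247] -/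
theorem hLapG_dirB (hT1 : T₁ = liftOpY 𝔸 M)
    (hKB : M.submatrix (fun v : ↥B => (v : FBondY i)) (fun v : ↥B => (v : FBondY i)) *
      KB.submatrix (fun v : ↥B => (v : FBondY i)) (fun v : ↥B => (v : FBondY i)) = 1) {A δ : ℝ} (Rr : ℝ) (H : Prop)
    (h₃ : HasMajorant (g := toB6 (geoCK i q) Rr H) (blkV1 i.hN (cubeFamY i q))
      (LapV (P := B6GlobalChartV1.PV d ℓ i.m i.K hd hL) i.cf ∘ₗ Matrix.toLin' (indDiagY B * KB * indDiagY B))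
      (fun y y' => A * Real.exp (-(δ * (geoCK i q).dist y y')))) :
    HasMajorant (g := toB6 (geoCK i q) Rr H) (blkBK i q) (LapK b i * GiK b i T₁ B)
      (fun a a' => A * Real.exp (-(δ * (geoCK i q).dist a a'))) := by
  rw [LapK, GiK, ← B9Eq352DivFormLetters.conj_mul]
  refine hasMajorant_conj_of_liftY b (g := toB6 (geoCK i q) Rr H) (blkV1 i.hN (cubeFamY i q)) _ _ (fun J E => ?_) h₃
  rw [Module.End.mul_apply, dirInvY_liftY i hT1 hKB, LinearMap.restrictScalars_apply, liftEndY_liftY, LinearMap.comp_apply, Matrix.toLin'_apply]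

/-- ★★ **THE THREE ROWS FROM A (2.136)-SHAPED DECAY OF THE INTERIOR KERNEL** (FILE 1's reading + this §): for ANY flat operator `T₁ = M♯`, bond set `B` and real
`K_B` inverting the compression — so for the member-levelled letter of the current heads with a RAW displayed decay, and for print's cube-levelled letter
with the NAMED one (§3). [cite: Balaban1984PropagatorsII, Prop. 2.6 (2.136) p.247, (2.51) p.232; Balaban1985BackgroundPropagators, Thm 3.3 p.399, (3.42) p.397, Cor. 3.5 p.407, p.409 l.1–5] -/
theorem rows_GiK_of_ineq2136 (hT1 : T₁ = liftOpY 𝔸 M)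
    (hKB : M.submatrix (fun v : ↥B => (v : FBondY i)) (fun v : ↥B => (v : FBondY i)) *
      KB.submatrix (fun v : ↥B => (v : FBondY i)) (fun v : ↥B => (v : FBondY i)) = 1) (Rr : ℝ) (H : Prop)
    {C δ₃ : ℝ} {Cα Cε : ℝ → ℝ} {Cαε : ℝ → ℝ → ℝ} (hC : 0 ≤ C)
    (hdec : B6.Ineq2136_2140 (gFamOfKernelB i q (indDiagY B * KB * indDiagY B)) C Cα Cε Cαε δ₃) :
    HasMajorant (g := toB6 (geoCK i q) Rr H) (blkBK i q) (GiK b i T₁ B)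
        (fun a a' => C * (geoCK i q).len a ^ 2 * Real.exp (-(δ₃ * (geoCK i q).dist a a'))) ∧
    (∀ ν : Fin (d + 1), HasMajorant (g := toB6 (geoCK i q) Rr H) (blkBK i q) (DK b i ν * GiK b i T₁ B)
        (fun a a' => C * (geoCK i q).len a * Real.exp (-(δ₃ * (geoCK i q).dist a a')))) ∧
    HasMajorant (g := toB6 (geoCK i q) Rr H) (blkBK i q) (LapK b i * GiK b i T₁ B)
        (fun a a' => C * Real.exp (-(δ₃ * (geoCK i q).dist a a'))) := by
  obtain ⟨h₁, h₂, h₃⟩ := hasMajorant_of_ineq2136 i q (indDiagY B * KB * indDiagY B) Rr H hC hdec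
  exact ⟨hG_dirB b i q hT1 hKB Rr H h₁, fun ν => hDG_dirB b i q hT1 hKB Rr H ν (h₂ ν), hLapG_dirB b i q hT1 hKB Rr H h₃⟩

end Rows

/-! ## §3  ★★★ The print-faithful instance of `B6.Prop26DirichletPrinted` and the conditional `U = 1` rows for print's Dirichlet bond letter -/

section Instance

/-! ### The canonical compressed inverse `invOnB S M` (the zero-extension of `(M|_{S×S})⁻¹`) and its agreement with any displayed socket -/

section InvOn

variable {Y : Type} [Fintype Y] [DecidableEq Y]

/-- **THE CANONICAL DIRICHLET INVERSE OF A REAL MATRIX ON A SET `S`**: the zero-extension of `(M|_{S×S})⁻¹` (Mathlib's `Matrix.inv` on `↥S`; the genuine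
inverse where the compression is invertible). [cite: Balaban1985BackgroundPropagators, p.394 («(Ω₀Δ′_aΩ₀)⁻¹ … Its inverse is denoted by G′»), (3.27) p.395, bookkeeping] -/
def invOnB (S : Finset Y) (M : Matrix Y Y ℝ) : Matrix Y Y ℝ := fun x y =>
  if h : x ∈ S ∧ y ∈ S then (M.submatrix (fun v : ↥S => (v : Y)) (fun v : ↥S => (v : Y)))⁻¹ ⟨x, h.1⟩ ⟨y, h.2⟩ else 0

omit [Fintype Y] in
/-- its entries on `S × S`. [cite: Balaban1985BackgroundPropagators, p.394, bookkeeping] -/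
theorem invOnB_apply_of_mem (S : Finset Y) (M : Matrix Y Y ℝ) {x y : Y} (hx : x ∈ S) (hy : y ∈ S) :
    invOnB S M x y = (M.submatrix (fun v : ↥S => (v : Y)) (fun v : ↥S => (v : Y)))⁻¹ ⟨x, hx⟩ ⟨y, hy⟩ := by
  rw [invOnB, dif_pos ⟨hx, hy⟩]

omit [Fintype Y] in
/-- it vanishes off `S × S`. [cite: Balaban1985BackgroundPropagators, p.394, bookkeeping] -/
theorem invOnB_apply_of_not (S : Finset Y) (M : Matrix Y Y ℝ) {x y : Y} (h : ¬ (x ∈ S ∧ y ∈ S)) : invOnB S M x y = 0 := by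
  rw [invOnB, dif_neg h]

/-- `𝟙_S · invOnB S M · 𝟙_S = invOnB S M`. [cite: Balaban1985BackgroundPropagators, p.394, bookkeeping] -/
theorem compr_invOnB (S : Finset Y) (M : Matrix Y Y ℝ) : indDiagY S * invOnB S M * indDiagY S = invOnB S M := by
  ext x y
  rw [compr_apply]
  split_ifs with h
  · rfl
  · exact (invOnB_apply_of_not S M h).symm

/-- ★ **ANY DISPLAYED SOCKET AGREES WITH THE CANONICAL INVERSE ON `S`**: `M|_S K|_S = 1` ⇒ `𝟙_S K 𝟙_S = invOnB S M` (uniqueness of the inverse,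
`Matrix.inv_eq_right_inv`). [cite: Balaban1985BackgroundPropagators, p.394 («Its inverse»), bookkeeping] -/
theorem compr_eq_invOnB (S : Finset Y) {M K : Matrix Y Y ℝ}
    (hK : M.submatrix (fun v : ↥S => (v : Y)) (fun v : ↥S => (v : Y)) * K.submatrix (fun v : ↥S => (v : Y)) (fun v : ↥S => (v : Y)) = 1) :
    indDiagY S * K * indDiagY S = invOnB S M := by
  have hinv := Matrix.inv_eq_right_inv hK
  ext x y
  rw [compr_apply]
  split_ifs with h
  · rw [invOnB_apply_of_mem S M h.1 h.2, hinv]; rfl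
  · exact (invOnB_apply_of_not S M h).symm

end InvOn

variable {𝔸 : Type} [NormedRing 𝔸] [NormedAlgebra ℂ 𝔸] [CompleteSpace 𝔸]
variable {ι : Type} [Fintype ι] (b : Module.Basis ι ℝ 𝔸)

/-- **the canonical block inverse `(Q′_□G′_□(1)²Q′*_□)⁻¹` on the blocks inside `Ω₀(□)`** at g31's Dirichlet site kernel `GpDirOneY` (zero-extended).
[cite: Balaban1985BackgroundPropagators, (3.25) p.394, p.409 l.3–5 («C_□(U)»), Cor. 3.5 p.407] -/
def kxDirC (i : KIdx d ℓ hd hL b₀ b₁) (q : ↥(cubes (toKT i).D.toDomains)) : Matrix (BlkCubeY i q) (BlkCubeY i q) ℝ :=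
  invOnB (insideBlkY i q (dirDomY i q)) (xDirMatY i q (dirDomY i q) (GpDirOneY i q))

/-- **THE FLAT MATRIX OF PRINT's DIRICHLET BOND OPERATOR `Δ_{loc,□}(1) − DP_□(1)D*` OF THE CUBE SEQUENCE** (n06-j's `mlocDirCMatY` at g31's site kernel and the
canonical block inverse): the CUBE-FAMILY-levelled flat operator (LOCATED-34). [cite: Balaban1985BackgroundPropagators, (3.26) p.395 («coincides with Δ_a in (2.19) if U = 1»), p.408 («for this sequence»), p.409 l.3–5] -/
def mDirC (i : KIdx d ℓ hd hL b₀ b₁) (q : ↥(cubes (toKT i).D.toDomains)) : Matrix (FBondY i) (FBondY i) ℝ :=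
  mlocDirCMatY i q (dirDomY i q) (GpDirOneY i q) (kxDirC i q)

/-- ★ **THE CANONICAL `U = 1` DIRICHLET BOND KERNEL OF THE CUBE SEQUENCE** `K_□ := 𝟙_B (M_□|_{B×B})⁻¹ 𝟙_B`, `B = bondsOverY Ω₀(□)` — print's `G_□(1)` as a
real matrix. [cite: Balaban1985BackgroundPropagators, (3.27) p.395, p.409 l.3–5 («G_□(U)»), Cor. 3.5 p.407; Balaban1984PropagatorsII, p.228 («G(Ω) = (ΩΔ_aΩ)⁻¹»)] -/
def kDirC (i : KIdx d ℓ hd hL b₀ b₁) (q : ↥(cubes (toKT i).D.toDomains)) : Matrix (FBondY i) (FBondY i) ℝ :=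
  invOnB (bondsOverY i (dirDomY i q)) (mDirC i q)

variable (i : KIdx d ℓ hd hL b₀ b₁) (q : ↥(cubes (toKT i).D.toDomains))

/-- under the block socket `hKX`, n06-j's matrix at the socket IS the canonical matrix `mDirC` (the projection reads `K_X` only through `𝟙_𝔖 K_X 𝟙_𝔖`).
[cite: Balaban1985BackgroundPropagators, (3.25)–(3.26) pp.394–395, p.409 l.3–5, bookkeeping] -/
theorem mlocDirCMatY_eq_mDirC {KX : Matrix (BlkCubeY i q) (BlkCubeY i q) ℝ}
    (hKX : (xDirMatY i q (dirDomY i q) (GpDirOneY i q)).submatrix (fun v : ↥(insideBlkY i q (dirDomY i q)) => (v : BlkCubeY i q))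
        (fun v : ↥(insideBlkY i q (dirDomY i q)) => (v : BlkCubeY i q)) *
      KX.submatrix (fun v : ↥(insideBlkY i q (dirDomY i q)) => (v : BlkCubeY i q)) (fun v : ↥(insideBlkY i q (dirDomY i q)) => (v : BlkCubeY i q)) = 1) :
    mlocDirCMatY i q (dirDomY i q) (GpDirOneY i q) KX = mDirC i q := by
  rw [mDirC, mlocDirCMatY, mlocDirCMatY, pDirMatY, pDirMatY, kxDirC, compr_eq_invOnB _ hKX, compr_invOnB]

/-- under the bond socket `hKB` (for the canonical matrix), the displayed kernel's interior IS the canonical kernel `kDirC`.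
[cite: Balaban1985BackgroundPropagators, (3.27) p.395, p.409 l.3–5, bookkeeping] -/
theorem compr_eq_kDirC {KB : Matrix (FBondY i) (FBondY i) ℝ}
    (hKB : (mDirC i q).submatrix (fun v : ↥(bondsOverY i (dirDomY i q)) => (v : FBondY i)) (fun v : ↥(bondsOverY i (dirDomY i q)) => (v : FBondY i)) *
      KB.submatrix (fun v : ↥(bondsOverY i (dirDomY i q)) => (v : FBondY i)) (fun v : ↥(bondsOverY i (dirDomY i q)) => (v : FBondY i)) = 1) :
    indDiagY (bondsOverY i (dirDomY i q)) * KB * indDiagY (bondsOverY i (dirDomY i q)) = kDirC i q :=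
  compr_eq_invOnB _ hKB

/-! ### The instance: index, domains, admissibility, the family `GΩ`, and the conditional theorem -/

variable (d ℓ hd hL b₀ b₁) in
/-- the index of the instance: a member of the V1 census and one of its cover cubes (the cube sequence `{Ω_n(□)}` is determined by the pair).
[cite: Balaban1985BackgroundPropagators, p.408 («Let us take a cube □ ∈ 𝒟_j»), dictionary] -/
abbrev CubeIdxB : Type := Σ i : KIdx d ℓ hd hL b₀ b₁, ↥(cubes (toKT i).D.toDomains)

/-- the [4]-geometries of the instance (FILE 1's `geoDirB`). [cite: Balaban1984PropagatorsII, (2.1)–(2.4) p.224; Balaban1985BackgroundPropagators, p.408, dictionary] -/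
abbrev geoDirBI (p : CubeIdxB d ℓ hd hL b₀ b₁) : B6.Geometry := geoDirB p.1 p.2

/-- the domain sort of the instance: site sets of the member's torus (print's «Ω»). [cite: Balaban1984PropagatorsII, p.228 («a neighbourhood Ω of the domain Ω₁»), dictionary] -/
abbrev domDirBI (p : CubeIdxB d ℓ hd hL b₀ b₁) : Type := Finset (SiteY p.1)

/-- admissibility: `Ω = Ω₀(□)` — g31's Dirichlet box `dirDomY i □ ⊋ C₁(□) = Ω₁(□)` with a level-0 collar of at least one top block (print p. 228: «Ω ⊃ Ω₁ … a sum of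
big blocks of the lattice T₁»; `B9CubeSequence408Mirrors.window_sub_box`, `mem_dirDomC_of_InC`). [cite: Balaban1984PropagatorsII, p.228, p.248 l.4–5; Balaban1985BackgroundPropagators, p.408 («Ω₀(□) ⊂ □⁵»), dictionary] -/
def admDirBI (p : CubeIdxB d ℓ hd hL b₀ b₁) (S : domDirBI p) : Prop := S = dirDomY p.1 p.2

/-- **THE FAMILY `GΩ` OF THE INSTANCE: print's `G_□(1) = (Ω₀(Δ_{loc,□} − DP_□D*)(1)Ω₀)⁻¹` SEEN THROUGH (2.136)** — FILE 1's `gFamOfKernelB` at the canonical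
Dirichlet bond kernel `kDirC` (defined for every `S`; read at the admissible `S = Ω₀(□)`). [cite: Balaban1984PropagatorsII, Prop. 2.6 (2.136) p.247, p.228, p.248 l.4–5; Balaban1985BackgroundPropagators, p.409 l.3–5, Cor. 3.5 p.407] -/
def GDirBFam (p : CubeIdxB d ℓ hd hL b₀ b₁) (_S : domDirBI p) : B6.GFamily (geoDirBI p) := gFamOfKernelB p.1 p.2 (kDirC p.1 p.2)

/-- ★★★ **THEOREM 3.3 AT `U = 1` FOR THE REALIFIED INTERIOR DIRICHLET BOND LETTER OF EVERY CUBE OF EVERY MEMBER, ONE SET OF CONSTANTS — CONDITIONAL BY NAME ON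
[4] PROP. 2.6 FOR `G(Ω)`** (Cor. 3.5's input «with U = 1, these theorems were proved in [4]», for print's `G_□` of p. 409): IF `B6.Prop26DirichletPrinted` holds
at the print-faithful family (`geoDirBI`, `domDirBI`, `admDirBI`, `GDirBFam`), THEN there are `M₁, δ₃, C > 0` such that for every member `i` above the
threshold `M₁ ≤ L·M_h`, every cover cube `□`, every `Rr, H`, every real basis `b`, every bond transporter `parB` trivial at `U = 1`, and all real `K_X`, `K_B`
filling n06-j's two inverse sockets at `S = Ω₀(□)` (the site socket `hK` is DISCHARGED by g31's `compress_mul_GpDirOneY`): with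
`T₁ := Δ_{loc,□}(1) − DP_□(1)D*` (`B9Eq3105AtLetters.deltaLocCubeY … 1 − DPDsDirCubeY i □ Ω₀(□) 1`) and `B := bondsOverY Ω₀(□)`, the interior letter
`GiK b i T₁ B = conj b((𝟙_B K_B 𝟙_B)♯)` satisfies `GiK ≺ C(Lⁿη)²e^{−δ₃d}`, `conj b(∇_ν)·GiK ≺ C(Lⁿη)e^{−δ₃d}` (all `ν`), `conj b(Δ)·GiK ≺ Ce^{−δ₃d}` over
`toB6 (geoCK i □) Rr H` keyed by `blkBK i □` — r05's `thm33_GK_cube` rows for print's Dirichlet letter.  The decay is the NAMED printed assertion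
(hypothesis `h26`), not proved here. [cite: Balaban1985BackgroundPropagators, Thm 3.3 p.399, (3.42) p.397, Cor. 3.5 p.407, p.409 l.1–5; Balaban1984PropagatorsII, Prop. 2.6 (2.136) p.247, p.228, p.248 l.4–5, (2.51) p.232] -/
theorem thm33_GdK_cube_of_prop26Dirichlet
    (h26 : B6.Prop26DirichletPrinted (geoDirBI (d := d) (ℓ := ℓ) (hd := hd) (hL := hL) (b₀ := b₀) (b₁ := b₁)) domDirBI admDirBI GDirBFam) :
    ∃ M₁ δ₃ C : ℝ, 0 < M₁ ∧ 0 < δ₃ ∧ 0 < C ∧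
    ∀ (i : KIdx d ℓ hd hL b₀ b₁) (q : ↥(cubes (toKT i).D.toDomains)) (Rr : ℝ) (H : Prop) (parB : BondParY 𝔸 i)
      (KX : Matrix (BlkCubeY i q) (BlkCubeY i q) ℝ) (KB : Matrix (FBondY i) (FBondY i) ℝ),
      (∀ s s', parB (fun _ _ => 1) s s' = 1) →
      (xDirMatY i q (dirDomY i q) (GpDirOneY i q)).submatrix (fun v : ↥(insideBlkY i q (dirDomY i q)) => (v : BlkCubeY i q))
          (fun v : ↥(insideBlkY i q (dirDomY i q)) => (v : BlkCubeY i q)) *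
        KX.submatrix (fun v : ↥(insideBlkY i q (dirDomY i q)) => (v : BlkCubeY i q)) (fun v : ↥(insideBlkY i q (dirDomY i q)) => (v : BlkCubeY i q)) = 1 →
      (mlocDirCMatY i q (dirDomY i q) (GpDirOneY i q) KX).submatrix (fun v : ↥(bondsOverY i (dirDomY i q)) => (v : FBondY i))
          (fun v : ↥(bondsOverY i (dirDomY i q)) => (v : FBondY i)) *
        KB.submatrix (fun v : ↥(bondsOverY i (dirDomY i q)) => (v : FBondY i)) (fun v : ↥(bondsOverY i (dirDomY i q)) => (v : FBondY i)) = 1 →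
      M₁ ≤ ((ℓ : ℝ) + 1) * i.Mh →
      HasMajorant (g := toB6 (geoCK i q) Rr H) (blkBK i q)
          (GiK b i (B9Eq3105AtLetters.deltaLocCubeY i q parB (fun _ _ => 1) - DPDsDirCubeY i q (dirDomY i q) (fun _ _ => 1)) (bondsOverY i (dirDomY i q)))
          (fun a a' => C * (geoCK i q).len a ^ 2 * Real.exp (-(δ₃ * (geoCK i q).dist a a'))) ∧
      (∀ ν : Fin (d + 1), HasMajorant (g := toB6 (geoCK i q) Rr H) (blkBK i q)
          (DK b i ν * GiK b i (B9Eq3105AtLetters.deltaLocCubeY i q parB (fun _ _ => 1) - DPDsDirCubeY i q (dirDomY i q) (fun _ _ => 1))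
            (bondsOverY i (dirDomY i q)))
          (fun a a' => C * (geoCK i q).len a * Real.exp (-(δ₃ * (geoCK i q).dist a a')))) ∧
      HasMajorant (g := toB6 (geoCK i q) Rr H) (blkBK i q)
          (LapK b i * GiK b i (B9Eq3105AtLetters.deltaLocCubeY i q parB (fun _ _ => 1) - DPDsDirCubeY i q (dirDomY i q) (fun _ _ => 1))
            (bondsOverY i (dirDomY i q)))
          (fun a a' => C * Real.exp (-(δ₃ * (geoCK i q).dist a a'))) := by
  obtain ⟨M₁, δ₃, C, Cα, Cε, Cαε, hM₁, hδ₃, hC, H⟩ := h26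
  refine ⟨M₁, δ₃, C, hM₁, hδ₃, hC, fun i q Rr Hh parB KX KB hparB hKX hKB hM => ?_⟩
  -- n06-j's `hT1` reading of the cube-levelled letter, with g31's site socket discharged
  have hT1 := deltaLocCubeY_sub_DPDsDirCubeY_one i hparB (dirDomY i q) (compress_mul_GpDirOneY i q) (𝔸 := 𝔸) hKX
  -- the socket matrix is the canonical one; the socket kernel's interior is the canonical kernel
  have hMc : mlocDirCMatY i q (dirDomY i q) (GpDirOneY i q) KX = mDirC i q := mlocDirCMatY_eq_mDirC i q hKX
  rw [hMc] at hT1 hKB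
  have hKc : indDiagY (bondsOverY i (dirDomY i q)) * KB * indDiagY (bondsOverY i (dirDomY i q)) = kDirC i q := compr_eq_kDirC i q hKB
  -- the named fact at the index `(i, □)` and the admissible domain `Ω₀(□)`
  have hineq : B6.Ineq2136_2140 (gFamOfKernelB i q (indDiagY (bondsOverY i (dirDomY i q)) * KB * indDiagY (bondsOverY i (dirDomY i q))))
      C Cα Cε Cαε δ₃ := by
    rw [hKc]
    have hM' : M₁ ≤ (geoDirBI ⟨i, q⟩).M := by rw [show (geoDirBI ⟨i, q⟩).M = ((ℓ : ℝ) + 1) * i.Mh from geoDirB_M i q]; exact hM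
    exact H ⟨i, q⟩ trivial hM' (dirDomY i q) rfl
  exact rows_GiK_of_ineq2136 b i q hT1 hKB Rr Hh hC.le hineq

end Instance

end Literature.MathematicalPhysics.QuantumFieldTheory.Balaban1983to89.B9Cor35GDirInputsAtOne
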